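import Literature.MathematicalPhysics.QuantumFieldTheory.Balaban1983to89.B9Eq3131Pointwise

/-!
# `Balaban1983to89.B9Eq3117Polarized` — T. Bałaban, *Propagators for lattice gauge theories in a background field*, Commun. Math. Phys. **99**
(1985) 389–434 [Balaban1985BackgroundPropagators], (3.117) p. 419 SEPARATED BY ORDER: the Hessian `Δ = Δ^η(U)` of (3.10)/(3.12) ON PURE GAUGE MODES
`D^η_Uλ` — «The last equality can be interpreted as almost invariance of the quadratic form, the error terms are small because the function
J = D*η⁻²Im ∂U is small» — as the two identities `⟨Dλ, ΔDλ⟩ = ⟨i[λ(b₋), (Dλ)(b)], J⟩` (the Hessian of a gauge mode is the third `J`-form of (3.120))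
and `2⟨A, ΔDλ⟩ = ⟨i[λ(b₋), A(b)] − i[A(b), R_bλ(b₊)], J⟩` (the first-order gauge variation of the Hessian is the `J`-commutator form), on the
exact-background lattice calculus of `B9Eq39Adjoint`/`B9Eq3117Current` — the CONTENT of the two «(3.117) letters» `K·D`, `Dᵀ·K` that r06 FILES 82/83
(`B9Eq3120StepDelta1Pi`, `B9Eq3130MatrixLetters`) take as hypotheses at p10's matrix level — with the quantitative form of «small because J is small»:
both forms are `≤ O(1)·sup|J|·sup|λ|·η^d‖·‖_{L¹}`; FILE 84 of the Sect. B–D programme of cell `lit-balaban`, seat r06 (B9 fold owner); rows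
**B9.Eq3.116** ((3.116)–(3.117)), **B9.Eq3.118** ((3.118)–(3.120)), **B9.Eq3.130** ((3.130)–(3.131)) — member cells; heads are the lead's word

statement-level skeleton of published theorems with citation tags; proofs where landed; nothing here is a claim about the Yang–Mills mass gap

CITATION HEADER (lean-in-tree rule).  B9 = [Balaban1985BackgroundPropagators] (held `paper:balaban1985-cmp99-background-propagators`, journal
page = PDF page + 388; p. 419 = render `b2b-balaban-ref1/pages/1985-cmp99-background-propagators/…-p031-x2.png` READ AS AN IMAGE by this seat, text
layer of pp. 419/421/422 re-read 2026-08-25).  p. 419 [PDF 31]: «Expanding the both sides of the identity according to (3.12), and comparing terms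
of the same order, we get the identities ⟨Dλ, J⟩ = 0, or D\*J = 0, ⟨A − Dλ, Δ(A − Dλ)⟩ = ⟨A, ΔA⟩ − ⟨i[λ(b₋), A(b)] − i[A(b), R_bλ(b₊)] −
i[λ(b₋),(Dλ)(b)], J⟩. (3.117) The last equality can be interpreted as almost invariance of the quadratic form, the error terms are small because
the function J = D\*η⁻² Im ∂U is small, if U satisfies the condition (3.36). From now on we assume that U satisfies the regularity conditions
(3.35), (3.36).»; p. 419: «… = ⟨A, ΔA⟩ − ⟨A, Δ′_πA⟩. (3.120) The quadratic form Δ′_π is a small perturbation of Δ. Later we will write bounds for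
this form»; pp. 421–422 [PDF 33–34]: «It is easy to find estimates for the operator Δ′_π, using Theorem 3.1 and the inequality (3.49), we have to
be careful only with the third term in the definition (3.120) of Δ′_π. One of the three derivatives there has to be applied either to an
expression on the right, or on the left, of Δ′_π.» … (3.131); p. 392 [PDF 4]: (3.10) `⟨A,ΔA⟩`, (3.11) `⟨A,J⟩ = Σ_b η^d tr A(b)J(b)`, (3.12).

WHAT IS PROVED (kernel; theorems only — 0 `def`, 0 named fact, 0 sorry).  Carrier: the exact-background lattice of `B9Eq39Adjoint` (sites `S`,
directions `ι`, shifts `T μ : S ≃ S`, background `U : ι → S → 𝔸ˣ` of units of a complete normed ℂ-algebra `𝔸`, `R(U)X = UXU⁻¹`, trace `τ`,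
pairing `bondPair` = (3.11), quadratic form `hessPair` = `⟨A,ΔA⟩` of (3.10)/(3.12), operator `B9Eq310Hermitian.deltaOp` = `Δ`, `covDη` = `D^η_U`
of (3.3), current `J` of (3.11), `ad a m = am − ma`), under B9 §3's standing hypotheses (commuting shifts, tracial continuous `τ`, `η ≠ 0`):
* §1 bookkeeping: `bondPair_neg_left/right`, `deltaOp_neg`, `hessPair_zero`, `hessPair_neg` (`Q(−A) = Q(A)`, from the polarization
  `B9Eq310Hermitian.hessPair_add`), `shiftJ_zero_right` (the bracket of (3.117) at `A = 0` is `−i[λ(b₋),(Dλ)(b)]`), `shiftJ_split` (bracket =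
  `A`-linear part `+ (−`third term`)`).
* §2 **`hessPair_covDη`** — `⟨D^ηλ, ΔD^ηλ⟩ = ⟨i[λ(b₋), (D^ηλ)(b)], J⟩` ((3.117) at `A = 0` with `Q(−Dλ) = Q(Dλ)`: the HESSIAN OF A PURE GAUGE MODE
  is the third `J`-form, the term of (3.120) print singles out on p. 421); **`two_mul_bondPair_deltaOp_covDη`** — `2⟨A, Δ(D^ηλ)⟩ = ⟨i[λ(b₋), A(b)]
  − i[A(b), R_bλ(b₊)], J⟩` for every `A`, `λ` (the `(A,λ)`-bilinear part of (3.117): `hessPair_add` against `Eq3117QuadShift_holds` and §2's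
  first identity), and the symmetric reading `two_mul_bondPair_covDη_deltaOp` (`2⟨D^ηλ, ΔA⟩ = …`, `Δ` symmetric: `bondPair_deltaOp_symm`).  In
  p10's matrix language `Dᵀ·K` and `K·D` ARE the `J`-commutator operators and `DᵀKD` is the third `J`-form (the content of FILES 82/83's
  letters `hJt`, `hJ1`; the real-coordinate bridge itself is not here, see below).
* §3 «THE ERROR TERMS ARE SMALL BECAUSE THE FUNCTION J IS SMALL», quantitatively, for `η > 0`, a background of operator-norm-one units
  (`‖U(b)‖, ‖U(b)⁻¹‖ ≤ 1`, so `|R_bX| ≤ |X|`: `B9Eq310Hermitian.norm_R_le`), `sup_b|J(b)| ≤ j₀`, `sup_x|λ(x)| ≤ l₀`: `norm_linJ_le` (the commutator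
  letter is `≤ 4l₀|A(b)|` pointwise); **`norm_two_mul_bondPair_deltaOp_covDη_le`** — `|2⟨A, ΔD^ηλ⟩| ≤ 4j₀l₀·‖τ‖η^dΣ_b|A(b)|`;
  **`norm_hessPair_covDη_le`** — `|⟨D^ηλ, ΔD^ηλ⟩| ≤ 2j₀l₀·‖τ‖η^dΣ_b|(D^ηλ)(b)|` (the `L¹ × L^∞` shape of (3.131), via
  `B9Eq3131Pointwise.norm_bondPair_le`, `norm_I_ad_le`).
* §4 (v1.1, append-only) (3.119)–(3.120) read through §2, for every map `P` (print: `P = G′RD*`), `λ = PA`: **`deltaPiPrime_eq`** —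
  `⟨A, Δ′_πA⟩ = 2⟨A, Δ(D^ηλ)⟩ − ⟨D^ηλ, Δ(D^ηλ)⟩` (`B9Eq3117Current.deltaPiPrime`; in p10's matrix language `Δ′_π = K − TᵀKT`, `T = 1 − DP`, r06
  FILE 82), `hessPi_eq` (`⟨A, Δ_πA⟩ = ⟨A, ΔA⟩ − 2⟨A, ΔD^ηλ⟩ + ⟨D^ηλ, ΔD^ηλ⟩`), **`norm_deltaPiPrime_le`** — «The quadratic form Δ′_π is a small
  perturbation of Δ» in the coarse form `|⟨A, Δ′_πA⟩| ≤ 4j₀l·‖τ‖η^dΣ|A| + 2j₀l·‖τ‖η^dΣ|D^ηPA|` given `sup|PA| ≤ l` (the printed (3.131) inserts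
  Thm 3.1/(3.49)/(3.36), not done here; the refined pointwise majorization is `B9Eq3131Pointwise.norm_deltaPiPrimeBil_le`).

HONEST SCOPE / NOT CLAIMED.  (i) Everything is at the level of the PAIRED forms `⟨·, Δ·⟩`, as print states (3.117)/(3.120); no operator
identity `Δ(D^ηλ) = …` is asserted (it would need non-degeneracy of the trace pairing, not assumed for an abstract `τ`).  (ii) `sup|J| ≤ j₀` is a
HYPOTHESIS; that (3.36) yields `j₀ = O(1)Mα₀(Lʲη)⁻³` is row B9.Eq3.35's (`B9Eq336CurrentBound`, `B9Ineq3131Regular`; cell GAPS G-B9-r06-3), not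
repeated.  (iii) The bridge from these identities to p10's real matrices `K·D`, `Dᵀ·K` of FILES 82/83 (a real coordinate system for the `𝔸`-valued
bond/site functions, as r06 FILE 74 does for `Δ⁽²⁾`) is NOT in this file (unit B9-CLOSURE §6).  (iv) The constants `4`, `2` are ours («O(1)»).
NOT summit progress.

RELATED IN THE TREE, NOT DUPLICATED (searched 2026-08-25: `lean search`/grep for `hessPair_covD`, `bondPair_deltaOp_covD`, `hessPair_neg`,
`hessPair_zero`, `deltaOp_neg`, `shiftJ_split` = ∅).  `B9Eq3117Current` (r06) proves (3.117) as printed (`Eq3117QuadShift_holds`, USED) and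
(3.120) (`eq3120`), not the order-separated forms; `B9Eq3131Pointwise` (r06, row B9.Eq3.130) polarizes the DEFECT form `⟨A₁, Δ′_πA₂⟩` in
`(A₁, A₂)` and majorizes it pointwise (USED: `norm_bondPair_le`, `norm_I_ad_le`) — the present file separates instead the Hessian `Δ` itself on
gauge modes; `B11Eq138Polarization` (r08) is [11] (138), the polarization `2⟨A, Δ′_πF⟩` at `P F = 0` (its `shiftJ_zero_left` is `λ = 0`; here
`A = 0`) — not imported, to keep [5] material upstream of [11]; NE9's `B9Eq3120DeltaPiPrimeForm*` bound `π†Δπ − Δ` in the `L²`/energy currency on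
torus carriers (different carrier and norm).  Also USED: `B9Eq310Hermitian` (`hessPair_add`, `bondPair_deltaOp_self/_symm`, `deltaOp_smul`,
`bondPair_add_left`, `norm_R_le`), `Beta.BackgroundVertices.ad`, `B9Eq39Adjoint` (`hessPair`, `bondPair`, `J`, `R`).  Unit `lit-balaban-r06`,
HOME `run/shared/lean/pub/lit-balaban/`.
-/

noncomputable section

open scoped BigOperators

namespace Literature.MathematicalPhysics.QuantumFieldTheory.Balaban1983to89.B9Eq3117Polarized

open Complex
open Literature.MathematicalPhysics.QuantumFieldTheory.Balaban1983to89
open Literature.MathematicalPhysics.QuantumFieldTheory.Balaban1983to89.Beta.BackgroundVertices (ad)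
open Literature.MathematicalPhysics.QuantumFieldTheory.Balaban1983to89.B9Eq39Adjoint
open Literature.MathematicalPhysics.QuantumFieldTheory.Balaban1983to89.B9Eq310Hermitian (deltaOp deltaOp_smul hessPair_add
  bondPair_deltaOp_self bondPair_deltaOp_symm bondPair_add_left norm_R_le)
open Literature.MathematicalPhysics.QuantumFieldTheory.Balaban1983to89.B9Eq3117Current (covDη shiftJ Eq3117QuadShift_holds)
open Literature.MathematicalPhysics.QuantumFieldTheory.Balaban1983to89.B9Eq3131Pointwise (norm_bondPair_le norm_I_ad_le)

variable {𝔸 : Type*} [NormedRing 𝔸] [NormedAlgebra ℂ 𝔸] [CompleteSpace 𝔸]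
variable {S : Type*} [Fintype S] {ι : Type*} [Fintype ι] [LinearOrder ι]
variable (T : ι → Equiv.Perm S) (U : ι → S → 𝔸ˣ)

/-! ## §1 Bookkeeping: the pairing (3.11) and the form (3.10) at `−A` and `0`; the bracket of (3.117) split by order -/

section Bookkeeping

omit [CompleteSpace 𝔸] [LinearOrder ι] in
/-- `⟨−B, E⟩ = −⟨B, E⟩` for the pairing (3.11). [cite: Balaban1985BackgroundPropagators, (3.11) p.392] -/
theorem bondPair_neg_left (η : ℝ) (d : ℕ) (τ : 𝔸 →ₗ[ℂ] ℂ) (B E : ι → S → 𝔸) : bondPair η d τ (-B) E = -bondPair η d τ B E := by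
  simp [bondPair, Finset.sum_neg_distrib, mul_neg]

omit [CompleteSpace 𝔸] [LinearOrder ι] in
/-- `⟨B, −E⟩ = −⟨B, E⟩` for the pairing (3.11). [cite: Balaban1985BackgroundPropagators, (3.11) p.392] -/
theorem bondPair_neg_right (η : ℝ) (d : ℕ) (τ : 𝔸 →ₗ[ℂ] ℂ) (B E : ι → S → 𝔸) : bondPair η d τ B (-E) = -bondPair η d τ B E := by
  simp [bondPair, Finset.sum_neg_distrib, mul_neg]

omit [CompleteSpace 𝔸] [Fintype S] in
/-- `Δ(−A) = −ΔA` (`B9Eq310Hermitian.deltaOp_smul` at `c = −1`). [cite: Balaban1985BackgroundPropagators, (3.10) p.392] -/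
theorem deltaOp_neg (η : ℝ) (A : ι → S → 𝔸) : deltaOp T U η (-A) = -deltaOp T U η A := by
  funext μ x
  have h := deltaOp_smul T U η (-1 : ℂ) A μ x
  rw [neg_one_smul, neg_one_smul] at h
  rw [h, Pi.neg_apply, Pi.neg_apply]

omit [CompleteSpace 𝔸] in
/-- `⟨0, Δ0⟩ = 0`. [cite: Balaban1985BackgroundPropagators, (3.10) p.392] -/
theorem hessPair_zero (τ : 𝔸 →ₗ[ℂ] ℂ) (hτ : ∀ a b : 𝔸, τ (a * b) = τ (b * a)) (η : ℝ) (d : ℕ) :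
    hessPair T U η d τ (0 : ι → S → 𝔸) = 0 := by
  rw [← bondPair_deltaOp_self T U τ hτ]
  simp [bondPair]

omit [CompleteSpace 𝔸] in
/-- `⟨−A, Δ(−A)⟩ = ⟨A, ΔA⟩` — the form (3.10) is quadratic (polarization `B9Eq310Hermitian.hessPair_add` at `B = −A`).
[cite: Balaban1985BackgroundPropagators, (3.10) p.392] -/
theorem hessPair_neg (τ : 𝔸 →ₗ[ℂ] ℂ) (hτ : ∀ a b : 𝔸, τ (a * b) = τ (b * a)) (η : ℝ) (d : ℕ) (A : ι → S → 𝔸) :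
    hessPair T U η d τ (-A) = hessPair T U η d τ A := by
  have h := hessPair_add T U τ hτ η d A (-A)
  rw [add_neg_cancel, hessPair_zero T U τ hτ, deltaOp_neg, bondPair_neg_right, bondPair_deltaOp_self T U τ hτ] at h
  linear_combination -h

omit [CompleteSpace 𝔸] [Fintype S] [Fintype ι] [LinearOrder ι] in
/-- the bracket of (3.117) at `A = 0` is minus its third term: `S_λ(0)(b) = −i[λ(b₋), (D^ηλ)(b)]`.
[cite: Balaban1985BackgroundPropagators, (3.117) p.419] -/
theorem shiftJ_zero_right (η : ℝ) (lam : S → 𝔸) :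
    shiftJ T U η lam (0 : ι → S → 𝔸) = -fun μ x => I • ad (lam x) (covDη T U η lam μ x) := by
  funext μ x
  simp [shiftJ]

omit [CompleteSpace 𝔸] [Fintype S] [Fintype ι] [LinearOrder ι] in
/-- the bracket of (3.117) split by order in `λ`: `S_λ(A) = (i[λ(b₋), A(b)] − i[A(b), R_bλ(b₊)]) − i[λ(b₋), (D^ηλ)(b)]`, as a sum of bond
functions. [cite: Balaban1985BackgroundPropagators, (3.117) p.419] -/
theorem shiftJ_split (η : ℝ) (lam : S → 𝔸) (A : ι → S → 𝔸) :
    shiftJ T U η lam A =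
      (fun μ x => I • ad (lam x) (A μ x) - I • ad (A μ x) (R (U μ x) (lam (T μ x)))) +
        -fun μ x => I • ad (lam x) (covDη T U η lam μ x) := by
  funext μ x
  simp only [shiftJ, Pi.add_apply, Pi.neg_apply]
  abel

end Bookkeeping

/-! ## §2 (3.117) separated by order: the Hessian on pure gauge modes -/

section Polarized

/-- **THE HESSIAN OF A PURE GAUGE MODE IS THE THIRD `J`-FORM**: `⟨D^ηλ, Δ(D^ηλ)⟩ = ⟨i[λ(b₋), (D^ηλ)(b)], J⟩` — (3.117) at `A = 0` together with
`⟨−B, Δ(−B)⟩ = ⟨B, ΔB⟩`; this is the term of (3.120) print singles out («we have to be careful only with the third term in the definition (3.120)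
of Δ′_π. One of the three derivatives there has to be applied either to an expression on the right, or on the left, of Δ′_π»).
[cite: Balaban1985BackgroundPropagators, (3.117) p.419, (3.120) p.419, p.421] -/
theorem hessPair_covDη (hT : ∀ μ ν x, T μ (T ν x) = T ν (T μ x)) (τ : 𝔸 →L[ℂ] ℂ) (hτ : ∀ a b : 𝔸, τ (a * b) = τ (b * a))
    {η : ℝ} (hη : η ≠ 0) (d : ℕ) (lam : S → 𝔸) :
    hessPair T U η d (τ : 𝔸 →ₗ[ℂ] ℂ) (covDη T U η lam) =
      bondPair η d (τ : 𝔸 →ₗ[ℂ] ℂ) (fun μ x => I • ad (lam x) (covDη T U η lam μ x)) (J T U η) := by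
  have hτ' : ∀ a b : 𝔸, (τ : 𝔸 →ₗ[ℂ] ℂ) (a * b) = (τ : 𝔸 →ₗ[ℂ] ℂ) (b * a) := by simpa using hτ
  have h := Eq3117QuadShift_holds T U η d τ hT hτ hη 0 lam
  have h0 : (fun μ x => (0 : ι → S → 𝔸) μ x - covDη T U η lam μ x) = -covDη T U η lam := by
    funext μ x; simp
  rw [h0, hessPair_neg T U _ hτ', hessPair_zero T U _ hτ', shiftJ_zero_right, bondPair_neg_left] at h
  linear_combination h

/-- **THE FIRST-ORDER GAUGE VARIATION OF THE HESSIAN IS THE `J`-COMMUTATOR FORM**: for every bond function `A` and every `λ`,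
`2⟨A, Δ(D^ηλ)⟩ = ⟨i[λ(b₋), A(b)] − i[A(b), R_bλ(b₊)], J⟩` — the `(A, λ)`-bilinear part of (3.117) (polarization of `⟨A − Dλ, Δ(A − Dλ)⟩` by
`B9Eq310Hermitian.hessPair_add` against `B9Eq3117Current.Eq3117QuadShift_holds` and `hessPair_covDη`); «almost invariance of the quadratic form,
the error terms are small because the function J … is small». [cite: Balaban1985BackgroundPropagators, (3.117) p.419, (3.120) p.419] -/
theorem two_mul_bondPair_deltaOp_covDη (hT : ∀ μ ν x, T μ (T ν x) = T ν (T μ x)) (τ : 𝔸 →L[ℂ] ℂ) (hτ : ∀ a b : 𝔸, τ (a * b) = τ (b * a))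
    {η : ℝ} (hη : η ≠ 0) (d : ℕ) (A : ι → S → 𝔸) (lam : S → 𝔸) :
    2 * bondPair η d (τ : 𝔸 →ₗ[ℂ] ℂ) A (deltaOp T U η (covDη T U η lam)) =
      bondPair η d (τ : 𝔸 →ₗ[ℂ] ℂ) (fun μ x => I • ad (lam x) (A μ x) - I • ad (A μ x) (R (U μ x) (lam (T μ x)))) (J T U η) := by
  have hτ' : ∀ a b : 𝔸, (τ : 𝔸 →ₗ[ℂ] ℂ) (a * b) = (τ : 𝔸 →ₗ[ℂ] ℂ) (b * a) := by simpa using hτ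
  have h := Eq3117QuadShift_holds T U η d τ hT hτ hη A lam
  have hA : (fun μ x => A μ x - covDη T U η lam μ x) = A + -covDη T U η lam := by
    funext μ x; simp [sub_eq_add_neg]
  have hq := hessPair_covDη T U hT τ hτ hη d lam
  rw [hA, hessPair_add T U _ hτ', hessPair_neg T U _ hτ', deltaOp_neg, bondPair_neg_right, shiftJ_split, bondPair_add_left,
    bondPair_neg_left, ← hq] at h
  linear_combination -h

/-- the same read on the other side (`Δ` is symmetric for (3.11), `B9Eq310Hermitian.bondPair_deltaOp_symm`):
`2⟨D^ηλ, ΔA⟩ = ⟨i[λ(b₋), A(b)] − i[A(b), R_bλ(b₊)], J⟩`. [cite: Balaban1985BackgroundPropagators, (3.117) p.419, (3.10) p.392] -/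
theorem two_mul_bondPair_covDη_deltaOp (hT : ∀ μ ν x, T μ (T ν x) = T ν (T μ x)) (τ : 𝔸 →L[ℂ] ℂ) (hτ : ∀ a b : 𝔸, τ (a * b) = τ (b * a))
    {η : ℝ} (hη : η ≠ 0) (d : ℕ) (A : ι → S → 𝔸) (lam : S → 𝔸) :
    2 * bondPair η d (τ : 𝔸 →ₗ[ℂ] ℂ) (covDη T U η lam) (deltaOp T U η A) =
      bondPair η d (τ : 𝔸 →ₗ[ℂ] ℂ) (fun μ x => I • ad (lam x) (A μ x) - I • ad (A μ x) (R (U μ x) (lam (T μ x)))) (J T U η) := by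
  have hτ' : ∀ a b : 𝔸, (τ : 𝔸 →ₗ[ℂ] ℂ) (a * b) = (τ : 𝔸 →ₗ[ℂ] ℂ) (b * a) := by simpa using hτ
  rw [bondPair_deltaOp_symm T U _ hτ']
  exact two_mul_bondPair_deltaOp_covDη T U hT τ hτ hη d A lam

end Polarized

/-! ## §3 «the error terms are small because the function J is small» — quantitatively -/

section Small

omit [CompleteSpace 𝔸] [Fintype S] [Fintype ι] [LinearOrder ι] in
/-- the `J`-commutator letter is `≤ 4·sup|λ|·|A(b)|` pointwise for a background of operator-norm-one units (`|R_bX| ≤ |X|`, `|i[X,Y]| ≤ 2|X||Y|`):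
`|i[λ(b₋), A(b)] − i[A(b), R_bλ(b₊)]| ≤ 4 l₀ |A(b)|`. [cite: Balaban1985BackgroundPropagators, (3.117) p.419, (3.131) p.422] -/
theorem norm_linJ_le (hU1 : ∀ μ x, ‖(U μ x : 𝔸)‖ ≤ 1 ∧ ‖(((U μ x)⁻¹ : 𝔸ˣ) : 𝔸)‖ ≤ 1) {lam : S → 𝔸} {l₀ : ℝ}
    (hlam : ∀ x, ‖lam x‖ ≤ l₀) (A : ι → S → 𝔸) (μ : ι) (x : S) :
    ‖I • ad (lam x) (A μ x) - I • ad (A μ x) (R (U μ x) (lam (T μ x)))‖ ≤ 4 * l₀ * ‖A μ x‖ := by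
  have hR : ‖R (U μ x) (lam (T μ x))‖ ≤ l₀ := (norm_R_le (hU1 μ x).1 (hU1 μ x).2 _).trans (hlam _)
  have h1 : ‖I • ad (lam x) (A μ x)‖ ≤ 2 * l₀ * ‖A μ x‖ :=
    (norm_I_ad_le _ _).trans (by nlinarith [hlam x, norm_nonneg (A μ x), norm_nonneg (lam x)])
  have h2 : ‖I • ad (A μ x) (R (U μ x) (lam (T μ x)))‖ ≤ 2 * l₀ * ‖A μ x‖ :=
    (norm_I_ad_le _ _).trans (by nlinarith [hR, norm_nonneg (A μ x), norm_nonneg (R (U μ x) (lam (T μ x)))])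
  calc ‖I • ad (lam x) (A μ x) - I • ad (A μ x) (R (U μ x) (lam (T μ x)))‖
      ≤ ‖I • ad (lam x) (A μ x)‖ + ‖I • ad (A μ x) (R (U μ x) (lam (T μ x)))‖ := norm_sub_le _ _
    _ ≤ 4 * l₀ * ‖A μ x‖ := by linarith

/-- **`|2⟨A, Δ(D^ηλ)⟩| ≤ 4j₀l₀ · ‖τ‖η^d Σ_b|A(b)|`** — the first-order gauge variation of the Hessian is small when `sup|J| ≤ j₀` is («the error
terms are small because the function J = D\*η⁻²Im ∂U is small»), for `η > 0`, a background of operator-norm-one units and `sup|λ| ≤ l₀`; the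
`L¹(A) × L^∞(λ)` shape of (3.131). [cite: Balaban1985BackgroundPropagators, (3.117) p.419, (3.131) p.422] -/
theorem norm_two_mul_bondPair_deltaOp_covDη_le (hT : ∀ μ ν x, T μ (T ν x) = T ν (T μ x)) (τ : 𝔸 →L[ℂ] ℂ)
    (hτ : ∀ a b : 𝔸, τ (a * b) = τ (b * a)) {η : ℝ} (hη : 0 < η) (d : ℕ)
    (hU1 : ∀ μ x, ‖(U μ x : 𝔸)‖ ≤ 1 ∧ ‖(((U μ x)⁻¹ : 𝔸ˣ) : 𝔸)‖ ≤ 1) {j₀ l₀ : ℝ} (hJ : ∀ μ x, ‖J T U η μ x‖ ≤ j₀)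
    {lam : S → 𝔸} (hlam : ∀ x, ‖lam x‖ ≤ l₀) (A : ι → S → 𝔸) :
    ‖2 * bondPair η d (τ : 𝔸 →ₗ[ℂ] ℂ) A (deltaOp T U η (covDη T U η lam))‖ ≤
      4 * j₀ * l₀ * (‖τ‖ * η ^ d * ∑ x, ∑ μ, ‖A μ x‖) := by
  rw [two_mul_bondPair_deltaOp_covDη T U hT τ hτ hη.ne' d A lam]
  refine (norm_bondPair_le τ hη d _ _).trans ?_
  have hc : 0 ≤ ‖τ‖ * η ^ d := mul_nonneg (norm_nonneg _) (pow_nonneg hη.le d)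
  have hterm : ∀ x μ, ‖I • ad (lam x) (A μ x) - I • ad (A μ x) (R (U μ x) (lam (T μ x)))‖ * ‖J T U η μ x‖
      ≤ 4 * l₀ * ‖A μ x‖ * j₀ := fun x μ =>
    mul_le_mul (norm_linJ_le T U hU1 hlam A μ x) (hJ μ x) (norm_nonneg _)
      (by nlinarith [norm_nonneg (A μ x), le_trans (norm_nonneg _) (hlam x)])
  calc ‖τ‖ * η ^ d * ∑ x, ∑ μ, ‖I • ad (lam x) (A μ x) - I • ad (A μ x) (R (U μ x) (lam (T μ x)))‖ * ‖J T U η μ x‖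
      ≤ ‖τ‖ * η ^ d * ∑ x, ∑ μ, 4 * l₀ * ‖A μ x‖ * j₀ :=
        mul_le_mul_of_nonneg_left (Finset.sum_le_sum fun x _ => Finset.sum_le_sum fun μ _ => hterm x μ) hc
    _ = 4 * j₀ * l₀ * (‖τ‖ * η ^ d * ∑ x, ∑ μ, ‖A μ x‖) := by
        simp only [Finset.mul_sum]
        exact Finset.sum_congr rfl fun x _ => Finset.sum_congr rfl fun μ _ => by ring

/-- **`|⟨D^ηλ, Δ(D^ηλ)⟩| ≤ 2j₀l₀ · ‖τ‖η^d Σ_b|(D^ηλ)(b)|`** — the Hessian of a pure gauge mode is small when `sup|J| ≤ j₀` is; the third term of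
(3.120), one derivative kept on `λ`, in the `L¹(Dλ) × L^∞(λ)` shape of (3.131).
[cite: Balaban1985BackgroundPropagators, (3.117) p.419, (3.120) p.419, (3.131) p.422] -/
theorem norm_hessPair_covDη_le (hT : ∀ μ ν x, T μ (T ν x) = T ν (T μ x)) (τ : 𝔸 →L[ℂ] ℂ) (hτ : ∀ a b : 𝔸, τ (a * b) = τ (b * a))
    {η : ℝ} (hη : 0 < η) (d : ℕ) {j₀ l₀ : ℝ} (hJ : ∀ μ x, ‖J T U η μ x‖ ≤ j₀) {lam : S → 𝔸} (hlam : ∀ x, ‖lam x‖ ≤ l₀) :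
    ‖hessPair T U η d (τ : 𝔸 →ₗ[ℂ] ℂ) (covDη T U η lam)‖ ≤
      2 * j₀ * l₀ * (‖τ‖ * η ^ d * ∑ x, ∑ μ, ‖covDη T U η lam μ x‖) := by
  rw [hessPair_covDη T U hT τ hτ hη.ne' d lam]
  refine (norm_bondPair_le τ hη d _ _).trans ?_
  have hc : 0 ≤ ‖τ‖ * η ^ d := mul_nonneg (norm_nonneg _) (pow_nonneg hη.le d)
  have hterm : ∀ x μ, ‖I • ad (lam x) (covDη T U η lam μ x)‖ * ‖J T U η μ x‖ ≤ 2 * l₀ * ‖covDη T U η lam μ x‖ * j₀ :=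
    fun x μ =>
    mul_le_mul ((norm_I_ad_le _ _).trans (by nlinarith [hlam x, norm_nonneg (covDη T U η lam μ x), norm_nonneg (lam x)]))
      (hJ μ x) (norm_nonneg _) (by nlinarith [norm_nonneg (covDη T U η lam μ x), le_trans (norm_nonneg _) (hlam x)])
  calc ‖τ‖ * η ^ d * ∑ x, ∑ μ, ‖I • ad (lam x) (covDη T U η lam μ x)‖ * ‖J T U η μ x‖
      ≤ ‖τ‖ * η ^ d * ∑ x, ∑ μ, 2 * l₀ * ‖covDη T U η lam μ x‖ * j₀ :=
        mul_le_mul_of_nonneg_left (Finset.sum_le_sum fun x _ => Finset.sum_le_sum fun μ _ => hterm x μ) hc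
    _ = 2 * j₀ * l₀ * (‖τ‖ * η ^ d * ∑ x, ∑ μ, ‖covDη T U η lam μ x‖) := by
        simp only [Finset.mul_sum]
        exact Finset.sum_congr rfl fun x _ => Finset.sum_congr rfl fun μ _ => by ring

end Small

/-! ## §4 (v1.1, append-only) (3.119)–(3.120) read through §2: `⟨A, Δ′_πA⟩ = 2⟨A, ΔD^ηλ⟩ − ⟨D^ηλ, ΔD^ηλ⟩`, `λ = PA` -/

section DeltaPiPrime

open Literature.MathematicalPhysics.QuantumFieldTheory.Balaban1983to89.B9Eq3117Current (deltaPiPrime hessPi eq3120)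

/-- **(3.120) IN THE LANGUAGE OF THE SYMMETRIC FORM**: for every map `P` from bond functions to site functions (print: `P = G′RD*`) and every `A`,
with `λ = PA`, `⟨A, Δ′_πA⟩ = 2⟨A, Δ(D^ηλ)⟩ − ⟨D^ηλ, Δ(D^ηλ)⟩` — the defect form (3.120) (`B9Eq3117Current.deltaPiPrime`, the bracket of (3.117) at
`λ = PA` paired with `J`) is the cross term minus the pure-gauge term of the Hessian; in p10's matrix language `Δ′_π = K − TᵀKT` with `T = 1 − DP`
(r06 FILE 82). [cite: Balaban1985BackgroundPropagators, (3.120) p.419, (3.117) p.419] -/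
theorem deltaPiPrime_eq (hT : ∀ μ ν x, T μ (T ν x) = T ν (T μ x)) (τ : 𝔸 →L[ℂ] ℂ) (hτ : ∀ a b : 𝔸, τ (a * b) = τ (b * a))
    {η : ℝ} (hη : η ≠ 0) (d : ℕ) (P : (ι → S → 𝔸) → S → 𝔸) (A : ι → S → 𝔸) :
    deltaPiPrime T U η d (τ : 𝔸 →ₗ[ℂ] ℂ) P A =
      2 * bondPair η d (τ : 𝔸 →ₗ[ℂ] ℂ) A (deltaOp T U η (covDη T U η (P A))) -
        hessPair T U η d (τ : 𝔸 →ₗ[ℂ] ℂ) (covDη T U η (P A)) := by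
  rw [deltaPiPrime, shiftJ_split, bondPair_add_left, bondPair_neg_left, two_mul_bondPair_deltaOp_covDη T U hT τ hτ hη d A (P A),
    hessPair_covDη T U hT τ hτ hη d (P A)]
  ring

/-- **(3.119) EXPANDED**: `⟨A, Δ_πA⟩ = ⟨A − Dλ, Δ(A − Dλ)⟩ = ⟨A, ΔA⟩ − 2⟨A, Δ(D^ηλ)⟩ + ⟨D^ηλ, Δ(D^ηλ)⟩`, `λ = PA` (`B9Eq3117Current.eq3120` and
`deltaPiPrime_eq`). [cite: Balaban1985BackgroundPropagators, (3.119) p.419, (3.120) p.419] -/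
theorem hessPi_eq (hT : ∀ μ ν x, T μ (T ν x) = T ν (T μ x)) (τ : 𝔸 →L[ℂ] ℂ) (hτ : ∀ a b : 𝔸, τ (a * b) = τ (b * a))
    {η : ℝ} (hη : η ≠ 0) (d : ℕ) (P : (ι → S → 𝔸) → S → 𝔸) (A : ι → S → 𝔸) :
    hessPi T U η d (τ : 𝔸 →ₗ[ℂ] ℂ) P A =
      hessPair T U η d (τ : 𝔸 →ₗ[ℂ] ℂ) A - 2 * bondPair η d (τ : 𝔸 →ₗ[ℂ] ℂ) A (deltaOp T U η (covDη T U η (P A))) +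
        hessPair T U η d (τ : 𝔸 →ₗ[ℂ] ℂ) (covDη T U η (P A)) := by
  rw [eq3120 T U hT τ hτ hη d P A, deltaPiPrime_eq T U hT τ hτ hη d P A]
  ring

/-- **THE DEFECT FORM IS SMALL WHEN `J` IS** — «The quadratic form Δ′_π is a small perturbation of Δ»: for `η > 0`, a background of operator-norm-one
units, `sup|J| ≤ j₀` and `sup|PA| ≤ l`, `|⟨A, Δ′_πA⟩| ≤ 4j₀l·‖τ‖η^dΣ_b|A(b)| + 2j₀l·‖τ‖η^dΣ_b|(D^ηPA)(b)|` (the coarse `L¹ × L^∞` form; the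
printed (3.131) inserts Theorem 3.1 / (3.49) / (3.36) for `P = G′RD*` and `J`, not done here; the refined pointwise majorization is
`B9Eq3131Pointwise.norm_deltaPiPrimeBil_le`). [cite: Balaban1985BackgroundPropagators, (3.120) p.419, (3.131) p.422] -/
theorem norm_deltaPiPrime_le (hT : ∀ μ ν x, T μ (T ν x) = T ν (T μ x)) (τ : 𝔸 →L[ℂ] ℂ) (hτ : ∀ a b : 𝔸, τ (a * b) = τ (b * a))
    {η : ℝ} (hη : 0 < η) (d : ℕ) (hU1 : ∀ μ x, ‖(U μ x : 𝔸)‖ ≤ 1 ∧ ‖(((U μ x)⁻¹ : 𝔸ˣ) : 𝔸)‖ ≤ 1) {j₀ : ℝ}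
    (hJ : ∀ μ x, ‖J T U η μ x‖ ≤ j₀) (P : (ι → S → 𝔸) → S → 𝔸) (A : ι → S → 𝔸) {l : ℝ} (hPA : ∀ x, ‖P A x‖ ≤ l) :
    ‖deltaPiPrime T U η d (τ : 𝔸 →ₗ[ℂ] ℂ) P A‖ ≤
      4 * j₀ * l * (‖τ‖ * η ^ d * ∑ x, ∑ μ, ‖A μ x‖) + 2 * j₀ * l * (‖τ‖ * η ^ d * ∑ x, ∑ μ, ‖covDη T U η (P A) μ x‖) := by
  rw [deltaPiPrime_eq T U hT τ hτ hη.ne' d P A]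
  exact (norm_sub_le _ _).trans (add_le_add (norm_two_mul_bondPair_deltaOp_covDη_le T U hT τ hτ hη d hU1 hJ hPA A)
    (norm_hessPair_covDη_le T U hT τ hτ hη d hJ hPA))

end DeltaPiPrime

end Literature.MathematicalPhysics.QuantumFieldTheory.Balaban1983to89.B9Eq3117Polarized

end
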